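import Summits.BirchSwinnertonDyer.BirchSwinnertonDyer.Theses.LeadingTerm
import Summits.BirchSwinnertonDyer.BirchSwinnertonDyer.Theses.SelmerRank
import Summits.BirchSwinnertonDyer.BirchSwinnertonDyer.Theorems.LeadingTermConsistencyCells
import Summits.BirchSwinnertonDyer.BirchSwinnertonDyer.Theorems.LeadingTermConsistencyStubDeficientTwoLeMatch
import Summits.BirchSwinnertonDyer.BirchSwinnertonDyer.Theorems.LeadingTermKatoCorankBound
import Literature.NumberTheory.EllipticCurves.OrdinaryPrimesProofs
import HarnessLib

/-!
# Line `Sketch` — skeleton v4 for crux `Consistency` (stmt-BirchSwinnertonDyer-16217)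

Crux (route `LeadingTerm`, #2): for every elliptic `E/ℚ` (globally minimal `W`), every good
ordinary `p ≥ 5`, canonical cyclotomic height datum `D` and newform `f` of `E`, with
`r := rank_ℤ E(ℚ)`: `Reg_∞ > 0 ∧ Ω⁺_f > 0 ∧ ∃ q : ℚ, L^{(r)}(E,1) = r!·q·Ω⁺_f·Reg_∞ ∧
[T^r]L_p(f,α)·log_p(γ)^r = q·(1-α⁻¹)²·Reg_p(D)`.

## Composition (lead `prover-line-stmt-BirchSwinnertonDyer-16217-c1-0`, cycle 2, 2026-08-17)

Line `Sketch` = the Schneider–Kato locus split cut along the `(r_MW, r_an)` cells (v1–v3, lead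
`…-16217-0`). v4 integrates the two route-choice rewirings (rchoice-21fcbdc6: S1m ⇐ item
`PAdicOrderKatoSideR2`; rchoice-21073028: S1b ⇐ items `SelmerRankLB`, `SelmerRankSmallImage`,
`KatoCorankBound`) and observes that the SAME three items empty EVERY deficient cell at once:
`r_MW < r_an ≤ corank_{ℤ_p} Sel_{p^∞}(E/ℚ) ≤ ord_T L_p(E,T)` (Selmer side by cases on `ρ̄_{E,p}`,
then Kato Thm 18.4 in corank form), so `[T^{r_MW}]L_p = 0` and the crux holds there with `q = 0`.
Hence, modulo ITEMS only, the crux is its diagonal in rank `≥ 2`: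

* `r_MW = 0` (all cells, any `D`): tree theorem `leadingTerm_consistency_of_rank_zero`.
* excess `r_MW > r_an`: empty by the route's crux #4 `SqueezeUBR2` (stmt-0145), item hypothesis.
* diagonal `r = 1`: the route's support `RankLeOne` (stmt-16219), item hypothesis.
* deficient `1 ≤ r_MW < r_an`: `deficient_coeff_eq_zero_of_items` from the items `KatoCorankBound`
  (this route's crux #5, stmt-18048: Kato, Astérisque 295 Thm 18.4, corank form), `SelmerRankLB`
  (route SelmerRank, stmt-0131: `r_an ≤ corank Sel_{p^∞}` at big-image good ordinary `p ≥ 5`; known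
  in print for `r_an ≤ 3`, open from `r_an = 4`) and `SelmerRankSmallImage` (stmt-14418); then
  `consistencyAt_of_coeff_eq_zero` (landed, `LeadingTermConsistencyCells`). The finer, item-lighter
  closures of v3 stay landed and valid: `(1, even)` unconditional
  (`coeff_one_padicLFunction_eq_zero_of_even`), `(≥ 2, mismatched)` from `PAdicOrderKatoSideR2` alone
  (`coeff_padicLFunction_eq_zero_of_katoSide_of_mismatch`), `(1, odd ≥ 3)` = former stub S1a by
  TORSION TRANSFER from five named facts (`stub_deficient_one_odd_of_facts`, p131764), former stub S1b
  from `PAdicOrderComparisonR2` or from the Selmer side + `kato_divisibility` (p131981).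
* diagonal `r_MW = r_an ≥ 2`: the ONE registered stub **S2** `stub_diagonal_two_le`, the
  rank-`≥ 2` `p`-adic Beilinson formula WITH its rational constant (Burns–Kurihara–Sano
  arXiv:1910.07404 Conj. 1.1 / Cor. 1.10; no theoretical evidence beyond `r = 1`, arXiv:2103.11535
  p. 2); its first conjunct alone is BSD-rationality `L^{(r)}(E,1)/(r!·Ω⁺_f·Reg_∞) ∈ ℚ` in rank
  `≥ 2` (open; e.g. `L''(389a1,1)/(2·Ω·Reg)`). Truth status landed: S2 ⇐ (Ш finite ∧ BSD formula on
  the diagonal) ∧ `PAdicBSDConjecture` ∧ period ratio (`stub_diagonal_two_le_of_bsd_conjectures`,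
  p132459). S2 is the planner's foreseen child `ConsistencyRankTwo → ConsistencyHigher` (route
  docstring, two-layer plan (b)).

`consistency_of_stubs (hUB : SqueezeUBR2) (hR1 : RankLeOne) (hKC : KatoCorankBound)
(hLB : SelmerRankLB) (hSI : SelmerRankSmallImage) : Consistency` concludes the crux BY NAME;
`stub_of_consistency` shows S2 is a literal restriction of the crux (no stub is stronger).
-/

set_option linter.dupNamespace false

namespace Summit.BirchSwinnertonDyer.BirchSwinnertonDyer.Theorems

open scoped MatrixGroups ModularForm
open CongruenceSubgroup Literature.NumberTheory.EllipticCurves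
  Literature.NumberTheory.EllipticCurves.ModularForms WeierstrassCurve
open Summit.BirchSwinnertonDyer.BirchSwinnertonDyer.Theses.LeadingTerm (Consistency RankLeOne
  SqueezeUBR2 KatoCorankBound KatoDivisibility ConsistencyOfKato)
open Summit.BirchSwinnertonDyer.BirchSwinnertonDyer.Theses.SelmerRank (SelmerRankLB
  SelmerRankSmallImage)

/-! ### The registered stub -/

/-- Stub **S2** (diagonal `r_MW = r_an ≥ 2`): the rank-`≥ 2` `p`-adic Beilinson formula with its
rational constant — the crux restricted to the diagonal in rank `≥ 2` (Burns–Kurihara–Sano,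
Generalized Perrin-Riou conjecture, arXiv:1910.07404 Conj. 1.1 / Cor. 1.10, formulated under
`r_an = r_MW`; open beyond `r = 1`). [cite: arXiv:1910.07404, Cor. 1.10] -/
theorem stub_diagonal_two_le :
    ∀ (W : WeierstrassCurve ℚ) [W.IsElliptic] [W.IsGloballyMinimal] (p : ℕ) [Fact p.Prime],
      5 ≤ p → IsOrdinaryAt W p → ∀ (D : PAdicHeightData W p), D.IsCanonical →
      ∀ ⦃N : ℕ⦄ [NeZero N] (f : CuspForm (Gamma0 N) 2), IsNewformOf W f →
        2 ≤ W.mordellWeilRank → W.analyticRank = W.mordellWeilRank →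
          0 < W.regulator ∧ 0 < plusPeriod f ∧ ∃ q : ℚ,
            iteratedDeriv W.mordellWeilRank W.entireLFunction 1 =
              (((W.mordellWeilRank.factorial : ℝ) * (q : ℝ) * plusPeriod f * W.regulator : ℝ) : ℂ) ∧
            PowerSeries.coeff W.mordellWeilRank (padicLFunction f (unitRoot W p : ℚ_[p])) *
                padicLog p (cyclotomicGenerator p) ^ W.mordellWeilRank =
              (q : ℚ_[p]) * (1 - (unitRoot W p : ℚ_[p])⁻¹) ^ 2 * padicRegulator D := by
  sorry

/-! ### Proved: every deficient cell, modulo items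

`deficient_coeff_eq_zero_of_items` (LANDED p133294, `LeadingTermConsistencyStubDeficientTwoLeMatch` §(C)):
`SelmerRankLB → SelmerRankSmallImage → KatoCorankBound → ∀ W p (5 ≤ p, good ordinary) f (newform),
1 ≤ r_MW → r_MW < r_an → [T^{r_MW}]L_p = 0`. Cell `(1, odd ≥ 3)` is ALSO closed modulo five named
facts by torsion transfer (`stub_deficient_one_odd_of_namedFacts`, LANDED p133884). -/

/-! ### Composition -/

/-- **Composition of line `Sketch` (skeleton v4).** From the route's items `SqueezeUBR2` (crux #4,
no excess rank), `RankLeOne` (the known diagonal slice `r ≤ 1`), `KatoCorankBound` (crux #5) and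
route SelmerRank's `SelmerRankLB`, `SelmerRankSmallImage`, and the one registered stub S2, the crux
`Consistency` follows BY NAME: `r_MW = 0` by `leadingTerm_consistency_of_rank_zero`; `r_MW > r_an`
is empty by `SqueezeUBR2`; `r_MW = r_an = 1` by `RankLeOne`, `≥ 2` by S2; `r_MW < r_an` with
`q = 0` by `deficient_coeff_eq_zero_of_items` and `consistencyAt_of_coeff_eq_zero`. [folklore] -/
theorem consistency_of_stubs (hUB : SqueezeUBR2) (hR1 : RankLeOne) (hKC : KatoCorankBound)
    (hLB : SelmerRankLB) (hSI : SelmerRankSmallImage) : Consistency := by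
  intro W _ _ p _ h5 hord D hD N _ f hf
  rcases Nat.eq_zero_or_pos W.mordellWeilRank with h0 | hpos
  · exact leadingTerm_consistency_of_rank_zero W p hord h0 D f hf
  have hub : W.mordellWeilRank ≤ W.analyticRank := hUB W
  rcases hub.eq_or_lt with heq | hlt
  · -- diagonal
    by_cases h1 : W.mordellWeilRank = 1
    · exact hR1 W p h5 hord h1.le heq.symm D hD f hf
    · exact stub_diagonal_two_le W p h5 hord D hD f hf (by omega) heq.symm
  · -- deficient: one vanishing coefficient, `q = 0`
    exact consistencyAt_of_coeff_eq_zero W p D f hf hlt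
      (deficient_coeff_eq_zero_of_items hLB hSI hKC W p h5 hord f hf hpos hlt)

/-- `Consistency_of`: alias of the composition under the harness's conventional name. [folklore] -/
theorem Consistency_of (hUB : SqueezeUBR2) (hR1 : RankLeOne) (hKC : KatoCorankBound)
    (hLB : SelmerRankLB) (hSI : SelmerRankSmallImage) : Consistency :=
  consistency_of_stubs hUB hR1 hKC hLB hSI

/-- **What the route's glue item `ConsistencyOfKato` (stmt-16799, rev 10:
`KatoDivisibility → SqueezeUBR2 → RankLeOne → Consistency`) still needs from this line**: the Selmer
side (`SelmerRankLB`, `SelmerRankSmallImage`) and the stub S2 — Kato's divisibility (crux #5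
`KatoDivisibility`, stmt-18082) gives `KatoCorankBound` by the landed
`leadingTerm_katoCorankBound_of_katoDivisibility`. [folklore] -/
theorem consistencyOfKato_of_stubs (hLB : SelmerRankLB) (hSI : SelmerRankSmallImage) :
    ConsistencyOfKato := fun hKD hUB hR1 =>
  consistency_of_stubs hUB hR1 (leadingTerm_katoCorankBound_of_katoDivisibility hKD) hLB hSI

/-! ### The stub is a literal restriction of the crux -/

/-- **No stub is stronger than the crux**: `Consistency → S2` (restriction to the diagonal in rank
`≥ 2`). [folklore] -/
theorem stub_of_consistency (hC : Consistency) :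
    ∀ (W : WeierstrassCurve ℚ) [W.IsElliptic] [W.IsGloballyMinimal] (p : ℕ) [Fact p.Prime],
      5 ≤ p → IsOrdinaryAt W p → ∀ (D : PAdicHeightData W p), D.IsCanonical →
      ∀ ⦃N : ℕ⦄ [NeZero N] (f : CuspForm (Gamma0 N) 2), IsNewformOf W f →
        2 ≤ W.mordellWeilRank → W.analyticRank = W.mordellWeilRank →
          0 < W.regulator ∧ 0 < plusPeriod f ∧ ∃ q : ℚ,
            iteratedDeriv W.mordellWeilRank W.entireLFunction 1 =
              (((W.mordellWeilRank.factorial : ℝ) * (q : ℝ) * plusPeriod f * W.regulator : ℝ) : ℂ) ∧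
            PowerSeries.coeff W.mordellWeilRank (padicLFunction f (unitRoot W p : ℚ_[p])) *
                padicLog p (cyclotomicGenerator p) ^ W.mordellWeilRank =
              (q : ℚ_[p]) * (1 - (unitRoot W p : ℚ_[p])⁻¹) ^ 2 * padicRegulator D :=
  fun W _ _ p _ h5 hord D hD _ _ f hf _ _ => hC W p h5 hord D hD f hf

/-- **What the crux contains on the archimedean side alone** (why S2 is crux-sized): at every
good ordinary `p ≥ 5` (one exists for every `E/ℚ`, `exists_good_ordinary_prime_holds`) the crux
yields BSD-RATIONALITY AT THE ALGEBRAIC RANK, `L^{(r_MW)}(E,1) ∈ ℚ·Ω⁺_f·Reg_∞(E)` — open in print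
whenever `r_MW = r_an ≥ 2` (Gross, PCMS 18 (2011), Conj. 2.10). A canonical datum to instantiate
the crux exists (`exists_isCanonical_holds`). [folklore] -/
theorem rationality_of_consistency (hC : Consistency) (W : WeierstrassCurve ℚ) [W.IsElliptic]
    [W.IsGloballyMinimal] (p : ℕ) [Fact p.Prime] (h5 : 5 ≤ p) (hord : IsOrdinaryAt W p) {N : ℕ}
    [NeZero N] (f : CuspForm (Gamma0 N) 2) (hf : IsNewformOf W f) :
    ∃ q : ℚ, iteratedDeriv W.mordellWeilRank W.entireLFunction 1 =
      (((W.mordellWeilRank.factorial : ℝ) * (q : ℝ) * plusPeriod f * W.regulator : ℝ) : ℂ) := by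
  obtain ⟨D, hD⟩ := exists_isCanonical_holds W p h5 hord.1 hord.2
  obtain ⟨-, -, q, hA, -⟩ := hC W p h5 hord D hD f hf
  exact ⟨q, hA⟩

/-! ### Promotion-ready split of S2 (for the planner; two-layer plan (b))

S2 is the conjunction of two INDEPENDENT conjecture-grade statements, split along the mathematics
(kernel-checked below, `stub_diagonal_two_le_iff_rationality_and_transfer`):

* (R) **BSD-rationality at the rank**, `p`-FREE: for `r_MW = r_an ≥ 2`,
  `L^{(r)}(E,1) ∈ ℚ · r! · Ω⁺_f · Reg_∞(E)` (Tate 1974 Conj. 4(b) / Gross PCMS 18 Conj. 2.10 read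
  modulo `ℚ^×`; open in rank `≥ 2` — no Gross–Zagier formula for `L''`).
* (T) **`p`-adic Beilinson transfer GIVEN the archimedean constant**: for `r_MW = r_an ≥ 2`, every
  good ordinary `p ≥ 5`, canonical `D`: whenever `q ∈ ℚ` satisfies `L^{(r)}(E,1) = r!·q·Ω⁺_f·Reg_∞`,
  also `[T^r]L_p·log_p(γ)^r = q·(1-α⁻¹)²·Reg_p(D)` (Burns–Kurihara–Sano arXiv:1910.07404 Cor. 1.10
  shape; Perrin-Riou's formula is its `r = 1` case).

(R) ∧ (T) → S2 is immediate; S2 → (R) by restriction (a good ordinary `p ≥ 5` and a canonical `D`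
always exist: `exists_good_ordinary_prime_holds`, `exists_isCanonical_holds`); S2 → (T) because the
archimedean identity determines `q` (`r!·Ω⁺_f·Reg_∞ ≠ 0`). Splitting S2 by rank instead
(`r = 2` / `r ≥ 3`, the docstring's `ConsistencyRankTwo → ConsistencyHigher`) is a one-line case split. -/

/-- **S2 ⟺ (R) BSD-rationality at the rank ∧ (T) the `p`-adic transfer given the constant.**
[folklore] -/
theorem stub_diagonal_two_le_iff_rationality_and_transfer :
    (∀ (W : WeierstrassCurve ℚ) [W.IsElliptic] [W.IsGloballyMinimal] (p : ℕ) [Fact p.Prime],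
      5 ≤ p → IsOrdinaryAt W p → ∀ (D : PAdicHeightData W p), D.IsCanonical →
      ∀ ⦃N : ℕ⦄ [NeZero N] (f : CuspForm (Gamma0 N) 2), IsNewformOf W f →
        2 ≤ W.mordellWeilRank → W.analyticRank = W.mordellWeilRank →
          0 < W.regulator ∧ 0 < plusPeriod f ∧ ∃ q : ℚ,
            iteratedDeriv W.mordellWeilRank W.entireLFunction 1 =
              (((W.mordellWeilRank.factorial : ℝ) * (q : ℝ) * plusPeriod f * W.regulator : ℝ) : ℂ) ∧
            PowerSeries.coeff W.mordellWeilRank (padicLFunction f (unitRoot W p : ℚ_[p])) *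
                padicLog p (cyclotomicGenerator p) ^ W.mordellWeilRank =
              (q : ℚ_[p]) * (1 - (unitRoot W p : ℚ_[p])⁻¹) ^ 2 * padicRegulator D) ↔
    ((∀ (W : WeierstrassCurve ℚ) [W.IsElliptic] [W.IsGloballyMinimal]
        ⦃N : ℕ⦄ [NeZero N] (f : CuspForm (Gamma0 N) 2), IsNewformOf W f →
        2 ≤ W.mordellWeilRank → W.analyticRank = W.mordellWeilRank →
          ∃ q : ℚ, iteratedDeriv W.mordellWeilRank W.entireLFunction 1 =
            (((W.mordellWeilRank.factorial : ℝ) * (q : ℝ) * plusPeriod f * W.regulator : ℝ) : ℂ)) ∧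
     (∀ (W : WeierstrassCurve ℚ) [W.IsElliptic] [W.IsGloballyMinimal] (p : ℕ) [Fact p.Prime],
      5 ≤ p → IsOrdinaryAt W p → ∀ (D : PAdicHeightData W p), D.IsCanonical →
      ∀ ⦃N : ℕ⦄ [NeZero N] (f : CuspForm (Gamma0 N) 2), IsNewformOf W f →
        2 ≤ W.mordellWeilRank → W.analyticRank = W.mordellWeilRank → ∀ q : ℚ,
          iteratedDeriv W.mordellWeilRank W.entireLFunction 1 =
              (((W.mordellWeilRank.factorial : ℝ) * (q : ℝ) * plusPeriod f * W.regulator : ℝ) : ℂ) →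
            PowerSeries.coeff W.mordellWeilRank (padicLFunction f (unitRoot W p : ℚ_[p])) *
                padicLog p (cyclotomicGenerator p) ^ W.mordellWeilRank =
              (q : ℚ_[p]) * (1 - (unitRoot W p : ℚ_[p])⁻¹) ^ 2 * padicRegulator D)) := by
  constructor
  · intro hS2
    refine ⟨fun W _ _ N _ f hf h2 hdiag => ?_, fun W _ _ p _ h5 hord D hD N _ f hf h2 hdiag q hA => ?_⟩
    · obtain ⟨p, hp, h5, hgood, hord⟩ := WeierstrassCurve.exists_good_ordinary_prime_holds W
      obtain ⟨D, hD⟩ := exists_isCanonical_holds W p h5 hgood hord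
      obtain ⟨-, -, q, hA, -⟩ := hS2 W p h5 ⟨hgood, hord⟩ D hD f hf h2 hdiag
      exact ⟨q, hA⟩
    · obtain ⟨hreg, hΩ, q', hA', hP'⟩ := hS2 W p h5 hord D hD f hf h2 hdiag
      -- the archimedean identity determines `q`
      have hqq : q = q' := by
        have hfac : (0 : ℝ) < W.mordellWeilRank.factorial := by exact_mod_cast Nat.factorial_pos _
        have h : ((W.mordellWeilRank.factorial : ℝ) * (q : ℝ) * plusPeriod f * W.regulator : ℝ) =
            ((W.mordellWeilRank.factorial : ℝ) * (q' : ℝ) * plusPeriod f * W.regulator : ℝ) := by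
          exact_mod_cast hA.symm.trans hA'
        have hne : (W.mordellWeilRank.factorial : ℝ) * plusPeriod f * W.regulator ≠ 0 :=
          mul_ne_zero (mul_ne_zero hfac.ne' hΩ.ne') hreg.ne'
        have : ((q : ℝ) - q') * ((W.mordellWeilRank.factorial : ℝ) * plusPeriod f * W.regulator) = 0 := by
          linear_combination h
        have hq : (q : ℝ) = q' := by
          have := (mul_eq_zero.mp this).resolve_right hne
          linarith
        exact_mod_cast hq
      subst hqq
      exact hP'
  · rintro ⟨hR, hT⟩ W _ _ p _ h5 hord D hD N _ f hf h2 hdiag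
    obtain ⟨q, hA⟩ := hR W f hf h2 hdiag
    exact ⟨regulator_pos_holds W, IsNewform0.plusPeriod_pos_holds hf.1 hf.coeffField_eq_bot, q, hA,
      hT W p h5 hord D hD f hf h2 hdiag q hA⟩

end Summit.BirchSwinnertonDyer.BirchSwinnertonDyer.Theorems
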